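import Summits.Schanuel.Schanuel.Theorems.RootDecomp1JGapLemma

/-!
# The rank kernel of K₃ = `stmt-Schanuel-30523` and its first cell (route `RootDecomp1J`)

Support file for `stmt-Schanuel-30523` (`SchanuelOverPairClosedFields = Rel(⊤|𝓚₂)`, the declared residual
of `route-Schanuel-RootDecomp1J` rev 3: for `y ⊂ 𝓚₂` finite and any `z` `ℚ`-free modulo the pair hull `𝓚₂`,
`trdeg_{ℚ(y,e^y)} ℚ(y,e^y)(z, e^z) ≥ |z|`).  Unconditional; nothing here proves Schanuel or K₃.

* **RANK KERNEL** (`relOnRank_of_blockClosed`): over an `N`-block-closed space (`N ≥ 1`) every instance of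
  every `Rel(E''|E)` of rank `m ≤ N + 1` HOLDS.  For the literal item: **K₃ holds at every rank `m ≤ 3`**
  (`pairHull_rank_le_three_lit`, the item's clause with `m ≤ 3 →` inserted — a decided layer of the
  residual, outside the regime where Schanuel's conjecture is known) and **`K₃ ↔ K₃[m ≥ 4]`**
  (`pK3_iff_rank_ge_four_lit`, both sides literal).  Likewise `𝔊_N = Rel(𝓚_{N+1}|𝓚_N)` holds at rank
  `≤ N + 1` (`couplingGrade_rank_le`).
* **CIRCUITS** (`circuit_of_cost_le`): over an `N`-block-closed `E`, a free `(N+2)`-tuple of cost `≤ N + 1`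
  (the first rank at which `Rel(·|E)` can fail) has ALL its `(N+1)`-sub-tuples hereditary `(N+1)`-blocks of
  exact cost `N + 1`.  **The first cell of K₃ is `m = 4` and it is a circuit** (`pairHull_firstCell_lit`).
* **Deficient exp-`3`-cycles are never free modulo a `2`-block-closed space** (`three_le_trdeg_threeCycle_of_free`,
  `not_free_pairHull_of_deficient_threeCycle_lit`): an exp-`3`-cycle with an algebraic relation is coupled
  to `𝓚₂` by a non-trivial `ℚ`-relation — it is a cell of G₂ = 30522 or lower, not of K₃ (this corrects the
  v7–v9 reading «first cell of K₃: a deficient exp-3-cycle at m = 3»).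

The base space is identified LITERALLY: `pairHullLit_eq : (𝓚₂ as written in the item) = blockHull 2 (𝓚 as
written in the item) := rfl`.

Provenance: decomposition cell `decomp-schanuel`, lens 3, NODE v10 §33.2–§33.3 (kernel-checked there);
ported verbatim + literal specialisations. [this cell's]
-/

set_option linter.dupNamespace false

noncomputable section

open Complex IntermediateField
open Literature.Barriers.Schanuel (trdeg_mono)
open Summit.Schanuel.Schanuel.Theorems.RootDecomp1DFlagSplit (trdeg_adjoin_union_eq_add
  trdeg_adjoin_le_cardinalMk trdeg_gens_lt_aleph0 rel_iff_add disjoint_span_of_linearIndependent_mkQ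
  schanuelOn_of_relOn)
open Summit.Schanuel.Schanuel.Theorems.RootDecomp1JKhovanskiiBlocks (mem_and_isAlgebraic_exp_of_mem_span
  mem_and_isAlgebraic_exp_of_mem_span_set reltrdeg_le_of_isAlgebraic trdeg_witnessField_lt_aleph0)
open Summit.Schanuel.Schanuel.Theorems.RootDecomp1JBlockHulls
open Summit.Schanuel.Schanuel.Theorems.RootDecomp1JGapLemma

namespace Summit.Schanuel.Schanuel.Theorems.RootDecomp1JRankKernel

/-! ### §1 The rank kernel -/

/-- **THE RANK KERNEL.** Over an `N`-block-closed space (`N ≥ 1`) every instance of every `Rel(E''|E)`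
of rank `m ≤ N + 1` holds. -/
theorem relOnRank_of_blockClosed {N : ℕ} (hN : 1 ≤ N) {E : Submodule ℚ ℂ} (hE : blockStep N E ≤ E)
    (E'' : Submodule ℚ ℂ) : RelOnRank E E'' (N + 1) := by
  intro k m y z hm hy _ hz
  rcases Nat.eq_zero_or_pos m with h0 | hm0
  · subst h0; simp
  by_cases hmN : m ≤ N
  · exact le_trans (by exact_mod_cast Nat.le_succ m) (gapOn_of_blockClosed hE hm0 hmN k y z hy hz)
  · have hmE : m = N + 1 := by omega
    subst hmE
    have hz' : LinearIndependent ℚ (E.mkQ ∘ (z ∘ Fin.castSucc)) :=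
      hz.comp Fin.castSucc (Fin.castSucc_injective N)
    calc ((N + 1 : ℕ) : Cardinal)
        ≤ Algebra.trdeg ↥(adjoin ℚ (Set.range y ∪ Set.range (cexp ∘ y)))
            ↥(adjoin ↥(adjoin ℚ (Set.range y ∪ Set.range (cexp ∘ y)))
              (Set.range (z ∘ Fin.castSucc) ∪ Set.range (cexp ∘ (z ∘ Fin.castSucc)))) :=
          gapOn_of_blockClosed hE hN le_rfl k y (z ∘ Fin.castSucc) hy hz'
      _ ≤ _ := reltrdeg_comp_le _ z Fin.castSucc

/-- **𝔊_N = `Rel(𝓚_{N+1}(⊥)|𝓚_N(⊥))` HOLDS AT EVERY RANK `≤ N + 1`** (`N ≥ 1`). -/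
theorem couplingGrade_rank_le {N : ℕ} (hN : 1 ≤ N) :
    RelOnRank (blockHull N ⊥) (blockHull (N + 1) ⊥) (N + 1) :=
  relOnRank_of_blockClosed hN (blockStep_blockHull N ⊥).le _

/-- `Rel(⊤|𝓚_N(F))` holds at every rank `≤ N + 1` (`N ≥ 1`), for every `F`. -/
theorem relOnRank_blockHull_top {N : ℕ} (hN : 1 ≤ N) (F : Submodule ℚ ℂ) :
    RelOnRank (blockHull N F) ⊤ (N + 1) :=
  relOnRank_of_blockClosed hN (blockStep_blockHull N F).le ⊤

/-! ### §2 Circuits and deficient `3`-cycles -/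

/-- **CIRCUITS.** Over an `N`-block-closed `E` (`N ≥ 1`), if a free `(N+2)`-tuple `z` costs `≤ N + 1`
over an `E`-field (the first rank at which `Rel(·|E)` can fail), then EVERY `(N+1)`-sub-tuple of `z` is a
hereditary `(N+1)`-block over `E` of exact cost `N + 1`. -/
theorem circuit_of_cost_le {N : ℕ} (hN : 1 ≤ N) {E : Submodule ℚ ℂ} (hE : blockStep N E ≤ E)
    {k : ℕ} {y : Fin k → ℂ} (hy : ∀ i, y i ∈ E) {z : Fin (N + 2) → ℂ}
    (hz : LinearIndependent ℚ (E.mkQ ∘ z))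
    (hcost : Algebra.trdeg ↥(adjoin ℚ (Set.range y ∪ Set.range (cexp ∘ y)))
      ↥(adjoin ↥(adjoin ℚ (Set.range y ∪ Set.range (cexp ∘ y))) (Set.range z ∪ Set.range (cexp ∘ z))) ≤
      ((N + 1 : ℕ) : Cardinal)) (j : Fin (N + 2)) :
    HBlock E (z ∘ j.succAbove) ∧
      Algebra.trdeg ↥(adjoin ℚ (Set.range y ∪ Set.range (cexp ∘ y)))
        ↥(adjoin ↥(adjoin ℚ (Set.range y ∪ Set.range (cexp ∘ y)))
          (Set.range (z ∘ j.succAbove) ∪ Set.range (cexp ∘ (z ∘ j.succAbove)))) =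
        ((N + 1 : ℕ) : Cardinal) := by
  have hz' : LinearIndependent ℚ (E.mkQ ∘ (z ∘ j.succAbove)) :=
    hz.comp j.succAbove Fin.succAbove_right_injective
  have hle := (reltrdeg_comp_le _ z j.succAbove).trans hcost
  exact ⟨blockCrit_of_blockClosed hE le_rfl k y (z ∘ j.succAbove) hy hz' hle,
    le_antisymm hle (relOnRank_of_blockClosed hN hE ⊤ k (N + 1) y _ le_rfl hy
      (fun _ => Submodule.mem_top) hz')⟩

/-- **DEFICIENT exp-`3`-CYCLES ARE NOT FREE MODULO A `2`-BLOCK-CLOSED SPACE** (in particular modulo K₃'s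
base `𝓚₂`): if `e^a = b`, `e^b = c` and the pair `(a, b)` is `ℚ`-free modulo `E ⊇ E^{B≤2}`, then
`trdeg ℚ(a, b, c) ≥ 3` (for a cycle, `e^c = a`, this is `(a, b, c)` algebraically independent).
Contrapositively an exp-`3`-cycle with an algebraic relation is coupled to `𝓚₂` by a non-trivial
`ℚ`-relation: it is a cell of G₂ or lower, not of K₃. -/
theorem three_le_trdeg_threeCycle_of_free {E : Submodule ℚ ℂ} (hE : blockStep 2 E ≤ E) {a b c : ℂ}
    (hab : cexp a = b) (hbc : cexp b = c) (hfree : LinearIndependent ℚ (E.mkQ ∘ ![a, b])) :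
    (3 : Cardinal) ≤ Algebra.trdeg ℚ ↥(adjoin ℚ ({a, b, c} : Set ℂ)) := by
  have h := gap_abs_of_blockClosed hE (s := 2) (by norm_num) le_rfl hfree
  have h3 : ((2 + 1 : ℕ) : Cardinal) = 3 := by norm_num
  rw [h3] at h
  have hsub : Set.range ![a, b] ∪ Set.range (cexp ∘ ![a, b]) ⊆ ({a, b, c} : Set ℂ) := by
    rintro x (⟨i, rfl⟩ | ⟨i, rfl⟩) <;> fin_cases i <;> simp [hab, hbc]
  exact h.trans (trdeg_mono (adjoin.mono _ _ _ hsub))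

/-! ### §3 The literal item K₃ = `stmt-Schanuel-30523` -/

/-- The item's base space `𝓚₂` (the pair hull of the curve hull `𝓚` of the EL-span, exactly as written in
`Theses/RootDecomp1J.lean`) IS `blockHull 2 𝓚`, definitionally. -/
theorem pairHullLit_eq :
    (⨆ n : ℕ, (fun E : Submodule ℚ ℂ => E ⊔ Submodule.span ℚ {x : ℂ | ∃ N : ℕ, N ≤ 2 ∧ ∃ w : Fin N → ℂ, (∃ Y : Finset ℂ, (↑Y : Set ℂ) ⊆ ↑E ∧ ∀ T : Finset ℂ, Y ⊆ T → ∀ (r : ℕ) (ρ : Fin r → Fin N), (∀ j, w j ∈ Submodule.span ℚ ((↑T : Set ℂ) ∪ Set.range (w ∘ ρ))) → Algebra.trdeg ↥(IntermediateField.adjoin ℚ ((↑T : Set ℂ) ∪ Complex.exp '' ↑T)) ↥(IntermediateField.adjoin ↥(IntermediateField.adjoin ℚ ((↑T : Set ℂ) ∪ Complex.exp '' ↑T)) (Set.range w ∪ Set.range (Complex.exp ∘ w))) ≤ r) ∧ x ∈ Set.range w})^[n + 1] (⨆ n : ℕ, (fun E : Submodule ℚ ℂ => E ⊔ Submodule.span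 ℚ {g : ℂ | ∃ Y : Finset ℂ, (↑Y : Set ℂ) ⊆ ↑E ∧ Algebra.trdeg ↥(IntermediateField.adjoin ℚ ((↑Y : Set ℂ) ∪ Complex.exp '' ↑Y)) ↥(IntermediateField.adjoin ↥(IntermediateField.adjoin ℚ ((↑Y : Set ℂ) ∪ Complex.exp '' ↑Y)) ({g, Complex.exp g} : Set ℂ)) ≤ 1})^[n + 1] (⨆ n : ℕ, (fun E : Submodule ℚ ℂ => (E ⊔ Submodule.span ℚ (Complex.exp '' ↑E)) ⊔ Submodule.span ℚ (Complex.exp ⁻¹' ↑(E ⊔ Submodule.span ℚ (Complex.exp '' ↑E))))^[n + 1] (Submodule.span ℚ ({z : ℂ | IsAlgebraic ℚ z} ∪ {z : ℂ | ∃ β l : ℂ, IsAlgebraic ℚ β ∧ IsAlgebraic ℚ (Complex.exp l) ∧ z = β * l}))))) =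
      blockHull 2 (⨆ n : ℕ, (fun E : Submodule ℚ ℂ => E ⊔ Submodule.span ℚ {g : ℂ | ∃ Y : Finset ℂ, (↑Y : Set ℂ) ⊆ ↑E ∧ Algebra.trdeg ↥(IntermediateField.adjoin ℚ ((↑Y : Set ℂ) ∪ Complex.exp '' ↑Y)) ↥(IntermediateField.adjoin ↥(IntermediateField.adjoin ℚ ((↑Y : Set ℂ) ∪ Complex.exp '' ↑Y)) ({g, Complex.exp g} : Set ℂ)) ≤ 1})^[n + 1] (⨆ n : ℕ, (fun E : Submodule ℚ ℂ => (E ⊔ Submodule.span ℚ (Complex.exp '' ↑E)) ⊔ Submodule.span ℚ (Complex.exp ⁻¹' ↑(E ⊔ Submodule.span ℚ (Complex.exp '' ↑E))))^[n + 1] (Submodule.span ℚ ({z : ℂ | IsAlgebraic ℚ z} ∪ {z : ℂ | ∃ β l : ℂ, IsAlgebraic ℚ β ∧ IsAlgebraic ℚ (Complex.exp l) ∧ z = β * l})))) := rfl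

/-- The item's curve hull `𝓚` IS `curveHull 𝓜` (`𝓜` the EL-span literal), definitionally. -/
theorem curveHullLit_eq :
    (⨆ n : ℕ, (fun E : Submodule ℚ ℂ => E ⊔ Submodule.span ℚ {g : ℂ | ∃ Y : Finset ℂ, (↑Y : Set ℂ) ⊆ ↑E ∧ Algebra.trdeg ↥(IntermediateField.adjoin ℚ ((↑Y : Set ℂ) ∪ Complex.exp '' ↑Y)) ↥(IntermediateField.adjoin ↥(IntermediateField.adjoin ℚ ((↑Y : Set ℂ) ∪ Complex.exp '' ↑Y)) ({g, Complex.exp g} : Set ℂ)) ≤ 1})^[n + 1] (⨆ n : ℕ, (fun E : Submodule ℚ ℂ => (E ⊔ Submodule.span ℚ (Complex.exp '' ↑E)) ⊔ Submodule.span ℚ (Complex.exp ⁻¹' ↑(E ⊔ Submodule.span ℚ (Complex.exp '' ↑E))))^[n + 1] (Submodule.span ℚ ({z : ℂ | IsAlgebraic ℚ z} ∪ {z : ℂ | ∃ β l : ℂ, IsAlgebraic ℚ β ∧ IsAlgebraic ℚ (Complex.exp l) ∧ z = β * l})))) =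
      curveHull (⨆ n : ℕ, (fun E : Submodule ℚ ℂ => (E ⊔ Submodule.span ℚ (Complex.exp '' ↑E)) ⊔ Submodule.span ℚ (Complex.exp ⁻¹' ↑(E ⊔ Submodule.span ℚ (Complex.exp '' ↑E))))^[n + 1] (Submodule.span ℚ ({z : ℂ | IsAlgebraic ℚ z} ∪ {z : ℂ | ∃ β l : ℂ, IsAlgebraic ℚ β ∧ IsAlgebraic ℚ (Complex.exp l) ∧ z = β * l}))) := rfl

/-- `𝓚₂` is `2`-block-closed. -/
theorem blockStep_pairHullLit_le :
    blockStep 2 (⨆ n : ℕ, (fun E : Submodule ℚ ℂ => E ⊔ Submodule.span ℚ {x : ℂ | ∃ N : ℕ, N ≤ 2 ∧ ∃ w : Fin N → ℂ, (∃ Y : Finset ℂ, (↑Y : Set ℂ) ⊆ ↑E ∧ ∀ T : Finset ℂ, Y ⊆ T → ∀ (r : ℕ) (ρ : Fin r → Fin N), (∀ j, w j ∈ Submodule.span ℚ ((↑T : Set ℂ) ∪ Set.range (w ∘ ρ))) → Algebra.trdeg ↥(IntermediateField.adjoin ℚ ((↑T : Set ℂ) ∪ Complex.exp '' ↑T)) ↥(IntermediateField.adjoin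 ↥(IntermediateField.adjoin ℚ ((↑T : Set ℂ) ∪ Complex.exp '' ↑T)) (Set.range w ∪ Set.range (Complex.exp ∘ w))) ≤ r) ∧ x ∈ Set.range w})^[n + 1] (⨆ n : ℕ, (fun E : Submodule ℚ ℂ => E ⊔ Submodule.span ℚ {g : ℂ | ∃ Y : Finset ℂ, (↑Y : Set ℂ) ⊆ ↑E ∧ Algebra.trdeg ↥(IntermediateField.adjoin ℚ ((↑Y : Set ℂ) ∪ Complex.exp '' ↑Y)) ↥(IntermediateField.adjoin ↥(IntermediateField.adjoin ℚ ((↑Y : Set ℂ) ∪ Complex.exp '' ↑Y)) ({g, Complex.exp g} : Set ℂ)) ≤ 1})^[n + 1] (⨆ n : ℕ, (fun E : Submodule ℚ ℂ => (E ⊔ Submodule.span ℚ (Complex.exp '' ↑E)) ⊔ Submodule.span ℚ (Complex.exp ⁻¹' ↑(E ⊔ Submodule.span ℚ (Complex.exp '' ↑E))))^[n + 1] (Submodule.span ℚ ({z : ℂ | IsAlgebraic ℚ z} ∪ {z : ℂ | ∃ β l : ℂ, IsAlgebraic ℚ β ∧ IsAlgebraic ℚ (Complex.exp l) ∧ z =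 β * l}))))) ≤
      (⨆ n : ℕ, (fun E : Submodule ℚ ℂ => E ⊔ Submodule.span ℚ {x : ℂ | ∃ N : ℕ, N ≤ 2 ∧ ∃ w : Fin N → ℂ, (∃ Y : Finset ℂ, (↑Y : Set ℂ) ⊆ ↑E ∧ ∀ T : Finset ℂ, Y ⊆ T → ∀ (r : ℕ) (ρ : Fin r → Fin N), (∀ j, w j ∈ Submodule.span ℚ ((↑T : Set ℂ) ∪ Set.range (w ∘ ρ))) → Algebra.trdeg ↥(IntermediateField.adjoin ℚ ((↑T : Set ℂ) ∪ Complex.exp '' ↑T)) ↥(IntermediateField.adjoin ↥(IntermediateField.adjoin ℚ ((↑T : Set ℂ) ∪ Complex.exp '' ↑T)) (Set.range w ∪ Set.range (Complex.exp ∘ w))) ≤ r) ∧ x ∈ Set.range w})^[n + 1] (⨆ n : ℕ, (fun E : Submodule ℚ ℂ => E ⊔ Submodule.span ℚ {g : ℂ | ∃ Y : Finset ℂ, (↑Y : Set ℂ) ⊆ ↑E ∧ Algebra.trdeg ↥(IntermediateField.adjoin ℚ ((↑Y : Set ℂ) ∪ Complex.exp '' ↑Y)) ↥(IntermediateField.adjoin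 ↥(IntermediateField.adjoin ℚ ((↑Y : Set ℂ) ∪ Complex.exp '' ↑Y)) ({g, Complex.exp g} : Set ℂ)) ≤ 1})^[n + 1] (⨆ n : ℕ, (fun E : Submodule ℚ ℂ => (E ⊔ Submodule.span ℚ (Complex.exp '' ↑E)) ⊔ Submodule.span ℚ (Complex.exp ⁻¹' ↑(E ⊔ Submodule.span ℚ (Complex.exp '' ↑E))))^[n + 1] (Submodule.span ℚ ({z : ℂ | IsAlgebraic ℚ z} ∪ {z : ℂ | ∃ β l : ℂ, IsAlgebraic ℚ β ∧ IsAlgebraic ℚ (Complex.exp l) ∧ z = β * l}))))) :=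
  (blockStep_blockHull 2 _).le

/-- `𝓚` is `1`-block-closed. -/
theorem blockStep_curveHullLit_le :
    blockStep 1 (⨆ n : ℕ, (fun E : Submodule ℚ ℂ => E ⊔ Submodule.span ℚ {g : ℂ | ∃ Y : Finset ℂ, (↑Y : Set ℂ) ⊆ ↑E ∧ Algebra.trdeg ↥(IntermediateField.adjoin ℚ ((↑Y : Set ℂ) ∪ Complex.exp '' ↑Y)) ↥(IntermediateField.adjoin ↥(IntermediateField.adjoin ℚ ((↑Y : Set ℂ) ∪ Complex.exp '' ↑Y)) ({g, Complex.exp g} : Set ℂ)) ≤ 1})^[n + 1] (⨆ n : ℕ, (fun E : Submodule ℚ ℂ => (E ⊔ Submodule.span ℚ (Complex.exp '' ↑E)) ⊔ Submodule.span ℚ (Complex.exp ⁻¹' ↑(E ⊔ Submodule.span ℚ (Complex.exp '' ↑E))))^[n + 1] (Submodule.span ℚ ({z : ℂ | IsAlgebraic ℚ z} ∪ {z : ℂ | ∃ β l : ℂ, IsAlgebraic ℚ β ∧ IsAlgebraic ℚ (Complex.exp l) ∧ z = β * l})))) ≤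
      (⨆ n : ℕ, (fun E : Submodule ℚ ℂ => E ⊔ Submodule.span ℚ {g : ℂ | ∃ Y : Finset ℂ, (↑Y : Set ℂ) ⊆ ↑E ∧ Algebra.trdeg ↥(IntermediateField.adjoin ℚ ((↑Y : Set ℂ) ∪ Complex.exp '' ↑Y)) ↥(IntermediateField.adjoin ↥(IntermediateField.adjoin ℚ ((↑Y : Set ℂ) ∪ Complex.exp '' ↑Y)) ({g, Complex.exp g} : Set ℂ)) ≤ 1})^[n + 1] (⨆ n : ℕ, (fun E : Submodule ℚ ℂ => (E ⊔ Submodule.span ℚ (Complex.exp '' ↑E)) ⊔ Submodule.span ℚ (Complex.exp ⁻¹' ↑(E ⊔ Submodule.span ℚ (Complex.exp '' ↑E))))^[n + 1] (Submodule.span ℚ ({z : ℂ | IsAlgebraic ℚ z} ∪ {z : ℂ | ∃ β l : ℂ, IsAlgebraic ℚ β ∧ IsAlgebraic ℚ (Complex.exp l) ∧ z = β * l})))) :=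
  blockStep_one_curveHull_le _

/-- **K₃ HOLDS AT EVERY RANK `m ≤ 3`:** the text of `SchanuelOverPairClosedFields` (stmt-Schanuel-30523) with
`m ≤ 3 →` inserted.  Over a `𝓚₂`-field a `ℚ`-free-modulo-`𝓚₂` single point costs `≥ 2`, a free pair
`≥ 3`, a free triple `≥ 3` — structurally, from `2`-block-closedness of `𝓚₂` alone. -/
theorem pairHull_rank_le_three_lit :
    ∀ (k m : ℕ) (y : Fin k → ℂ) (z : Fin m → ℂ), m ≤ 3 → (∀ i, y i ∈ (⨆ n : ℕ, (fun E : Submodule ℚ ℂ => E ⊔ Submodule.span ℚ {x : ℂ | ∃ N : ℕ, N ≤ 2 ∧ ∃ w : Fin N → ℂ, (∃ Y : Finset ℂ, (↑Y : Set ℂ) ⊆ ↑E ∧ ∀ T : Finset ℂ, Y ⊆ T → ∀ (r : ℕ) (ρ : Fin r → Fin N), (∀ j, w j ∈ Submodule.span ℚ ((↑T : Set ℂ) ∪ Set.range (w ∘ ρ))) → Algebra.trdeg ↥(IntermediateField.adjoin ℚ ((↑T : Set ℂ) ∪ Complex.exp '' ↑T)) ↥(IntermediateField.adjoin ↥(IntermediateField.adjoin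 ℚ ((↑T : Set ℂ) ∪ Complex.exp '' ↑T)) (Set.range w ∪ Set.range (Complex.exp ∘ w))) ≤ r) ∧ x ∈ Set.range w})^[n + 1] (⨆ n : ℕ, (fun E : Submodule ℚ ℂ => E ⊔ Submodule.span ℚ {g : ℂ | ∃ Y : Finset ℂ, (↑Y : Set ℂ) ⊆ ↑E ∧ Algebra.trdeg ↥(IntermediateField.adjoin ℚ ((↑Y : Set ℂ) ∪ Complex.exp '' ↑Y)) ↥(IntermediateField.adjoin ↥(IntermediateField.adjoin ℚ ((↑Y : Set ℂ) ∪ Complex.exp '' ↑Y)) ({g, Complex.exp g} : Set ℂ)) ≤ 1})^[n + 1] (⨆ n : ℕ, (fun E : Submodule ℚ ℂ => (E ⊔ Submodule.span ℚ (Complex.exp '' ↑E)) ⊔ Submodule.span ℚ (Complex.exp ⁻¹' ↑(E ⊔ Submodule.span ℚ (Complex.exp '' ↑E))))^[n + 1] (Submodule.span ℚ ({z : ℂ | IsAlgebraic ℚ z} ∪ {z : ℂ | ∃ β l : ℂ, IsAlgebraic ℚ β ∧ IsAlgebraic ℚ (Complex.exp l) ∧ z = β * l})))))) → LinearIndependent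 ℚ ((⨆ n : ℕ, (fun E : Submodule ℚ ℂ => E ⊔ Submodule.span ℚ {x : ℂ | ∃ N : ℕ, N ≤ 2 ∧ ∃ w : Fin N → ℂ, (∃ Y : Finset ℂ, (↑Y : Set ℂ) ⊆ ↑E ∧ ∀ T : Finset ℂ, Y ⊆ T → ∀ (r : ℕ) (ρ : Fin r → Fin N), (∀ j, w j ∈ Submodule.span ℚ ((↑T : Set ℂ) ∪ Set.range (w ∘ ρ))) → Algebra.trdeg ↥(IntermediateField.adjoin ℚ ((↑T : Set ℂ) ∪ Complex.exp '' ↑T)) ↥(IntermediateField.adjoin ↥(IntermediateField.adjoin ℚ ((↑T : Set ℂ) ∪ Complex.exp '' ↑T)) (Set.range w ∪ Set.range (Complex.exp ∘ w))) ≤ r) ∧ x ∈ Set.range w})^[n + 1] (⨆ n : ℕ, (fun E : Submodule ℚ ℂ => E ⊔ Submodule.span ℚ {g : ℂ | ∃ Y : Finset ℂ, (↑Y : Set ℂ) ⊆ ↑E ∧ Algebra.trdeg ↥(IntermediateField.adjoin ℚ ((↑Y : Set ℂ) ∪ Complex.exp '' ↑Y)) ↥(IntermediateField.adjoin ↥(IntermediateField.adjoin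 ℚ ((↑Y : Set ℂ) ∪ Complex.exp '' ↑Y)) ({g, Complex.exp g} : Set ℂ)) ≤ 1})^[n + 1] (⨆ n : ℕ, (fun E : Submodule ℚ ℂ => (E ⊔ Submodule.span ℚ (Complex.exp '' ↑E)) ⊔ Submodule.span ℚ (Complex.exp ⁻¹' ↑(E ⊔ Submodule.span ℚ (Complex.exp '' ↑E))))^[n + 1] (Submodule.span ℚ ({z : ℂ | IsAlgebraic ℚ z} ∪ {z : ℂ | ∃ β l : ℂ, IsAlgebraic ℚ β ∧ IsAlgebraic ℚ (Complex.exp l) ∧ z = β * l}))))).mkQ ∘ z) → (m : Cardinal) ≤ Algebra.trdeg ↥(IntermediateField.adjoin ℚ (Set.range y ∪ Set.range (Complex.exp ∘ y))) ↥(IntermediateField.adjoin ↥(IntermediateField.adjoin ℚ (Set.range y ∪ Set.range (Complex.exp ∘ y))) (Set.range z ∪ Set.range (Complex.exp ∘ z))) :=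
  fun k m y z hm hy hz => relOnRank_blockHull_top (N := 2) (by norm_num)
    (⨆ n : ℕ, (fun E : Submodule ℚ ℂ => E ⊔ Submodule.span ℚ {g : ℂ | ∃ Y : Finset ℂ, (↑Y : Set ℂ) ⊆ ↑E ∧ Algebra.trdeg ↥(IntermediateField.adjoin ℚ ((↑Y : Set ℂ) ∪ Complex.exp '' ↑Y)) ↥(IntermediateField.adjoin ↥(IntermediateField.adjoin ℚ ((↑Y : Set ℂ) ∪ Complex.exp '' ↑Y)) ({g, Complex.exp g} : Set ℂ)) ≤ 1})^[n + 1] (⨆ n : ℕ, (fun E : Submodule ℚ ℂ => (E ⊔ Submodule.span ℚ (Complex.exp '' ↑E)) ⊔ Submodule.span ℚ (Complex.exp ⁻¹' ↑(E ⊔ Submodule.span ℚ (Complex.exp '' ↑E))))^[n + 1] (Submodule.span ℚ ({z : ℂ | IsAlgebraic ℚ z} ∪ {z : ℂ | ∃ β l : ℂ, IsAlgebraic ℚ β ∧ IsAlgebraic ℚ (Complex.exp l) ∧ z = β * l})))) k m y z hm hy (fun _ => Submodule.mem_top) hz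

/-- **`K₃ ↔ K₃[m ≥ 4]`** — the residual item IS its part of rank `≥ 4` (left side: the text of
stmt-Schanuel-30523 verbatim; right side: the same with `4 ≤ m →` inserted). -/
theorem pK3_iff_rank_ge_four_lit :
    (∀ (k m : ℕ) (y : Fin k → ℂ) (z : Fin m → ℂ), (∀ i, y i ∈ (⨆ n : ℕ, (fun E : Submodule ℚ ℂ => E ⊔ Submodule.span ℚ {x : ℂ | ∃ N : ℕ, N ≤ 2 ∧ ∃ w : Fin N → ℂ, (∃ Y : Finset ℂ, (↑Y : Set ℂ) ⊆ ↑E ∧ ∀ T : Finset ℂ, Y ⊆ T → ∀ (r : ℕ) (ρ : Fin r → Fin N), (∀ j, w j ∈ Submodule.span ℚ ((↑T : Set ℂ) ∪ Set.range (w ∘ ρ))) → Algebra.trdeg ↥(IntermediateField.adjoin ℚ ((↑T : Set ℂ) ∪ Complex.exp '' ↑T)) ↥(IntermediateField.adjoin ↥(IntermediateField.adjoin ℚ ((↑T : Set ℂ) ∪ Complex.exp '' ↑T)) (Set.range w ∪ Set.range (Complex.exp ∘ w))) ≤ r) ∧ x ∈ Set.range w})^[n + 1] (⨆ n : ℕ,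 (fun E : Submodule ℚ ℂ => E ⊔ Submodule.span ℚ {g : ℂ | ∃ Y : Finset ℂ, (↑Y : Set ℂ) ⊆ ↑E ∧ Algebra.trdeg ↥(IntermediateField.adjoin ℚ ((↑Y : Set ℂ) ∪ Complex.exp '' ↑Y)) ↥(IntermediateField.adjoin ↥(IntermediateField.adjoin ℚ ((↑Y : Set ℂ) ∪ Complex.exp '' ↑Y)) ({g, Complex.exp g} : Set ℂ)) ≤ 1})^[n + 1] (⨆ n : ℕ, (fun E : Submodule ℚ ℂ => (E ⊔ Submodule.span ℚ (Complex.exp '' ↑E)) ⊔ Submodule.span ℚ (Complex.exp ⁻¹' ↑(E ⊔ Submodule.span ℚ (Complex.exp '' ↑E))))^[n + 1] (Submodule.span ℚ ({z : ℂ | IsAlgebraic ℚ z} ∪ {z : ℂ | ∃ β l : ℂ, IsAlgebraic ℚ β ∧ IsAlgebraic ℚ (Complex.exp l) ∧ z = β * l})))))) → LinearIndependent ℚ ((⨆ n : ℕ, (fun E : Submodule ℚ ℂ => E ⊔ Submodule.span ℚ {x : ℂ | ∃ N : ℕ, N ≤ 2 ∧ ∃ w : Fin N → ℂ, (∃ Y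 : Finset ℂ, (↑Y : Set ℂ) ⊆ ↑E ∧ ∀ T : Finset ℂ, Y ⊆ T → ∀ (r : ℕ) (ρ : Fin r → Fin N), (∀ j, w j ∈ Submodule.span ℚ ((↑T : Set ℂ) ∪ Set.range (w ∘ ρ))) → Algebra.trdeg ↥(IntermediateField.adjoin ℚ ((↑T : Set ℂ) ∪ Complex.exp '' ↑T)) ↥(IntermediateField.adjoin ↥(IntermediateField.adjoin ℚ ((↑T : Set ℂ) ∪ Complex.exp '' ↑T)) (Set.range w ∪ Set.range (Complex.exp ∘ w))) ≤ r) ∧ x ∈ Set.range w})^[n + 1] (⨆ n : ℕ, (fun E : Submodule ℚ ℂ => E ⊔ Submodule.span ℚ {g : ℂ | ∃ Y : Finset ℂ, (↑Y : Set ℂ) ⊆ ↑E ∧ Algebra.trdeg ↥(IntermediateField.adjoin ℚ ((↑Y : Set ℂ) ∪ Complex.exp '' ↑Y)) ↥(IntermediateField.adjoin ↥(IntermediateField.adjoin ℚ ((↑Y : Set ℂ) ∪ Complex.exp '' ↑Y)) ({g, Complex.exp g} : Set ℂ)) ≤ 1})^[n + 1] (⨆ n : ℕ, (fun E : Submodule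 ℚ ℂ => (E ⊔ Submodule.span ℚ (Complex.exp '' ↑E)) ⊔ Submodule.span ℚ (Complex.exp ⁻¹' ↑(E ⊔ Submodule.span ℚ (Complex.exp '' ↑E))))^[n + 1] (Submodule.span ℚ ({z : ℂ | IsAlgebraic ℚ z} ∪ {z : ℂ | ∃ β l : ℂ, IsAlgebraic ℚ β ∧ IsAlgebraic ℚ (Complex.exp l) ∧ z = β * l}))))).mkQ ∘ z) → (m : Cardinal) ≤ Algebra.trdeg ↥(IntermediateField.adjoin ℚ (Set.range y ∪ Set.range (Complex.exp ∘ y))) ↥(IntermediateField.adjoin ↥(IntermediateField.adjoin ℚ (Set.range y ∪ Set.range (Complex.exp ∘ y))) (Set.range z ∪ Set.range (Complex.exp ∘ z)))) ↔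
    (∀ (k m : ℕ) (y : Fin k → ℂ) (z : Fin m → ℂ), 4 ≤ m → (∀ i, y i ∈ (⨆ n : ℕ, (fun E : Submodule ℚ ℂ => E ⊔ Submodule.span ℚ {x : ℂ | ∃ N : ℕ, N ≤ 2 ∧ ∃ w : Fin N → ℂ, (∃ Y : Finset ℂ, (↑Y : Set ℂ) ⊆ ↑E ∧ ∀ T : Finset ℂ, Y ⊆ T → ∀ (r : ℕ) (ρ : Fin r → Fin N), (∀ j, w j ∈ Submodule.span ℚ ((↑T : Set ℂ) ∪ Set.range (w ∘ ρ))) → Algebra.trdeg ↥(IntermediateField.adjoin ℚ ((↑T : Set ℂ) ∪ Complex.exp '' ↑T)) ↥(IntermediateField.adjoin ↥(IntermediateField.adjoin ℚ ((↑T : Set ℂ) ∪ Complex.exp '' ↑T)) (Set.range w ∪ Set.range (Complex.exp ∘ w))) ≤ r) ∧ x ∈ Set.range w})^[n + 1] (⨆ n : ℕ, (fun E : Submodule ℚ ℂ => E ⊔ Submodule.span ℚ {g : ℂ | ∃ Y : Finset ℂ, (↑Y : Set ℂ) ⊆ ↑E ∧ Algebra.trdeg ↥(IntermediateField.adjoin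 ℚ ((↑Y : Set ℂ) ∪ Complex.exp '' ↑Y)) ↥(IntermediateField.adjoin ↥(IntermediateField.adjoin ℚ ((↑Y : Set ℂ) ∪ Complex.exp '' ↑Y)) ({g, Complex.exp g} : Set ℂ)) ≤ 1})^[n + 1] (⨆ n : ℕ, (fun E : Submodule ℚ ℂ => (E ⊔ Submodule.span ℚ (Complex.exp '' ↑E)) ⊔ Submodule.span ℚ (Complex.exp ⁻¹' ↑(E ⊔ Submodule.span ℚ (Complex.exp '' ↑E))))^[n + 1] (Submodule.span ℚ ({z : ℂ | IsAlgebraic ℚ z} ∪ {z : ℂ | ∃ β l : ℂ, IsAlgebraic ℚ β ∧ IsAlgebraic ℚ (Complex.exp l) ∧ z = β * l})))))) → LinearIndependent ℚ ((⨆ n : ℕ, (fun E : Submodule ℚ ℂ => E ⊔ Submodule.span ℚ {x : ℂ | ∃ N : ℕ, N ≤ 2 ∧ ∃ w : Fin N → ℂ, (∃ Y : Finset ℂ, (↑Y : Set ℂ) ⊆ ↑E ∧ ∀ T : Finset ℂ, Y ⊆ T → ∀ (r : ℕ) (ρ : Fin r → Fin N), (∀ j, w j ∈ Submodule.span ℚ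 ((↑T : Set ℂ) ∪ Set.range (w ∘ ρ))) → Algebra.trdeg ↥(IntermediateField.adjoin ℚ ((↑T : Set ℂ) ∪ Complex.exp '' ↑T)) ↥(IntermediateField.adjoin ↥(IntermediateField.adjoin ℚ ((↑T : Set ℂ) ∪ Complex.exp '' ↑T)) (Set.range w ∪ Set.range (Complex.exp ∘ w))) ≤ r) ∧ x ∈ Set.range w})^[n + 1] (⨆ n : ℕ, (fun E : Submodule ℚ ℂ => E ⊔ Submodule.span ℚ {g : ℂ | ∃ Y : Finset ℂ, (↑Y : Set ℂ) ⊆ ↑E ∧ Algebra.trdeg ↥(IntermediateField.adjoin ℚ ((↑Y : Set ℂ) ∪ Complex.exp '' ↑Y)) ↥(IntermediateField.adjoin ↥(IntermediateField.adjoin ℚ ((↑Y : Set ℂ) ∪ Complex.exp '' ↑Y)) ({g, Complex.exp g} : Set ℂ)) ≤ 1})^[n + 1] (⨆ n : ℕ, (fun E : Submodule ℚ ℂ => (E ⊔ Submodule.span ℚ (Complex.exp '' ↑E)) ⊔ Submodule.span ℚ (Complex.exp ⁻¹' ↑(E ⊔ Submodule.span ℚ (Complex.exp '' ↑E))))^[n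 + 1] (Submodule.span ℚ ({z : ℂ | IsAlgebraic ℚ z} ∪ {z : ℂ | ∃ β l : ℂ, IsAlgebraic ℚ β ∧ IsAlgebraic ℚ (Complex.exp l) ∧ z = β * l}))))).mkQ ∘ z) → (m : Cardinal) ≤ Algebra.trdeg ↥(IntermediateField.adjoin ℚ (Set.range y ∪ Set.range (Complex.exp ∘ y))) ↥(IntermediateField.adjoin ↥(IntermediateField.adjoin ℚ (Set.range y ∪ Set.range (Complex.exp ∘ y))) (Set.range z ∪ Set.range (Complex.exp ∘ z)))) := by
  constructor
  · intro h k m y z _ hy hz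
    exact h k m y z hy hz
  · intro h k m y z hy hz
    by_cases hm : m ≤ 3
    · exact pairHull_rank_le_three_lit k m y z hm hy hz
    · exact h k m y z (by omega) hy hz

/-- **THE FIRST CELL OF K₃ IS `m = 4`, AND IT IS A CIRCUIT:** a `ℚ`-free-modulo-`𝓚₂` `4`-tuple of cost `≤ 3`
over a `𝓚₂`-field has all four of its triples hereditary `3`-blocks over `𝓚₂` of exact cost `3`. -/
theorem pairHull_firstCell_lit {k : ℕ} {y : Fin k → ℂ}
    (hy : ∀ i, y i ∈ (⨆ n : ℕ, (fun E : Submodule ℚ ℂ => E ⊔ Submodule.span ℚ {x : ℂ | ∃ N : ℕ, N ≤ 2 ∧ ∃ w : Fin N → ℂ, (∃ Y : Finset ℂ, (↑Y : Set ℂ) ⊆ ↑E ∧ ∀ T : Finset ℂ, Y ⊆ T → ∀ (r : ℕ) (ρ : Fin r → Fin N), (∀ j, w j ∈ Submodule.span ℚ ((↑T : Set ℂ) ∪ Set.range (w ∘ ρ))) → Algebra.trdeg ↥(IntermediateField.adjoin ℚ ((↑T : Set ℂ) ∪ Complex.exp '' ↑T)) ↥(IntermediateField.adjoin ↥(IntermediateField.adjoin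 ℚ ((↑T : Set ℂ) ∪ Complex.exp '' ↑T)) (Set.range w ∪ Set.range (Complex.exp ∘ w))) ≤ r) ∧ x ∈ Set.range w})^[n + 1] (⨆ n : ℕ, (fun E : Submodule ℚ ℂ => E ⊔ Submodule.span ℚ {g : ℂ | ∃ Y : Finset ℂ, (↑Y : Set ℂ) ⊆ ↑E ∧ Algebra.trdeg ↥(IntermediateField.adjoin ℚ ((↑Y : Set ℂ) ∪ Complex.exp '' ↑Y)) ↥(IntermediateField.adjoin ↥(IntermediateField.adjoin ℚ ((↑Y : Set ℂ) ∪ Complex.exp '' ↑Y)) ({g, Complex.exp g} : Set ℂ)) ≤ 1})^[n + 1] (⨆ n : ℕ, (fun E : Submodule ℚ ℂ => (E ⊔ Submodule.span ℚ (Complex.exp '' ↑E)) ⊔ Submodule.span ℚ (Complex.exp ⁻¹' ↑(E ⊔ Submodule.span ℚ (Complex.exp '' ↑E))))^[n + 1] (Submodule.span ℚ ({z : ℂ | IsAlgebraic ℚ z} ∪ {z : ℂ | ∃ β l : ℂ, IsAlgebraic ℚ β ∧ IsAlgebraic ℚ (Complex.exp l) ∧ z = β * l}))))))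
    {z : Fin 4 → ℂ}
    (hz : LinearIndependent ℚ ((⨆ n : ℕ, (fun E : Submodule ℚ ℂ => E ⊔ Submodule.span ℚ {x : ℂ | ∃ N : ℕ, N ≤ 2 ∧ ∃ w : Fin N → ℂ, (∃ Y : Finset ℂ, (↑Y : Set ℂ) ⊆ ↑E ∧ ∀ T : Finset ℂ, Y ⊆ T → ∀ (r : ℕ) (ρ : Fin r → Fin N), (∀ j, w j ∈ Submodule.span ℚ ((↑T : Set ℂ) ∪ Set.range (w ∘ ρ))) → Algebra.trdeg ↥(IntermediateField.adjoin ℚ ((↑T : Set ℂ) ∪ Complex.exp '' ↑T)) ↥(IntermediateField.adjoin ↥(IntermediateField.adjoin ℚ ((↑T : Set ℂ) ∪ Complex.exp '' ↑T)) (Set.range w ∪ Set.range (Complex.exp ∘ w))) ≤ r) ∧ x ∈ Set.range w})^[n + 1] (⨆ n : ℕ, (fun E : Submodule ℚ ℂ => E ⊔ Submodule.span ℚ {g : ℂ | ∃ Y : Finset ℂ, (↑Y : Set ℂ) ⊆ ↑E ∧ Algebra.trdeg ↥(IntermediateField.adjoin ℚ ((↑Y : Set ℂ) ∪ Complex.exp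 '' ↑Y)) ↥(IntermediateField.adjoin ↥(IntermediateField.adjoin ℚ ((↑Y : Set ℂ) ∪ Complex.exp '' ↑Y)) ({g, Complex.exp g} : Set ℂ)) ≤ 1})^[n + 1] (⨆ n : ℕ, (fun E : Submodule ℚ ℂ => (E ⊔ Submodule.span ℚ (Complex.exp '' ↑E)) ⊔ Submodule.span ℚ (Complex.exp ⁻¹' ↑(E ⊔ Submodule.span ℚ (Complex.exp '' ↑E))))^[n + 1] (Submodule.span ℚ ({z : ℂ | IsAlgebraic ℚ z} ∪ {z : ℂ | ∃ β l : ℂ, IsAlgebraic ℚ β ∧ IsAlgebraic ℚ (Complex.exp l) ∧ z = β * l}))))).mkQ ∘ z))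
    (hcost : Algebra.trdeg ↥(adjoin ℚ (Set.range y ∪ Set.range (cexp ∘ y)))
      ↥(adjoin ↥(adjoin ℚ (Set.range y ∪ Set.range (cexp ∘ y))) (Set.range z ∪ Set.range (cexp ∘ z))) ≤
      ((3 : ℕ) : Cardinal)) (j : Fin 4) :
    HBlock (⨆ n : ℕ, (fun E : Submodule ℚ ℂ => E ⊔ Submodule.span ℚ {x : ℂ | ∃ N : ℕ, N ≤ 2 ∧ ∃ w : Fin N → ℂ, (∃ Y : Finset ℂ, (↑Y : Set ℂ) ⊆ ↑E ∧ ∀ T : Finset ℂ, Y ⊆ T → ∀ (r : ℕ) (ρ : Fin r → Fin N), (∀ j, w j ∈ Submodule.span ℚ ((↑T : Set ℂ) ∪ Set.range (w ∘ ρ))) → Algebra.trdeg ↥(IntermediateField.adjoin ℚ ((↑T : Set ℂ) ∪ Complex.exp '' ↑T)) ↥(IntermediateField.adjoin ↥(IntermediateField.adjoin ℚ ((↑T : Set ℂ) ∪ Complex.exp '' ↑T)) (Set.range w ∪ Set.range (Complex.exp ∘ w))) ≤ r) ∧ x ∈ Set.range w})^[n + 1] (⨆ n : ℕ, (fun E :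 Submodule ℚ ℂ => E ⊔ Submodule.span ℚ {g : ℂ | ∃ Y : Finset ℂ, (↑Y : Set ℂ) ⊆ ↑E ∧ Algebra.trdeg ↥(IntermediateField.adjoin ℚ ((↑Y : Set ℂ) ∪ Complex.exp '' ↑Y)) ↥(IntermediateField.adjoin ↥(IntermediateField.adjoin ℚ ((↑Y : Set ℂ) ∪ Complex.exp '' ↑Y)) ({g, Complex.exp g} : Set ℂ)) ≤ 1})^[n + 1] (⨆ n : ℕ, (fun E : Submodule ℚ ℂ => (E ⊔ Submodule.span ℚ (Complex.exp '' ↑E)) ⊔ Submodule.span ℚ (Complex.exp ⁻¹' ↑(E ⊔ Submodule.span ℚ (Complex.exp '' ↑E))))^[n + 1] (Submodule.span ℚ ({z : ℂ | IsAlgebraic ℚ z} ∪ {z : ℂ | ∃ β l : ℂ, IsAlgebraic ℚ β ∧ IsAlgebraic ℚ (Complex.exp l) ∧ z = β * l}))))) (z ∘ j.succAbove) ∧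
      Algebra.trdeg ↥(adjoin ℚ (Set.range y ∪ Set.range (cexp ∘ y)))
        ↥(adjoin ↥(adjoin ℚ (Set.range y ∪ Set.range (cexp ∘ y)))
          (Set.range (z ∘ j.succAbove) ∪ Set.range (cexp ∘ (z ∘ j.succAbove)))) = ((3 : ℕ) : Cardinal) :=
  circuit_of_cost_le (N := 2) (by norm_num) blockStep_pairHullLit_le hy hz hcost j

/-- **A deficient exp-`3`-cycle's pair `(a, b)` is not free modulo `𝓚₂`** (`e^a = b`, `e^b = c`,
`trdeg ℚ(a, b, c) ≤ 2`): such cycles are cells of G₂ = 30522 or lower, invisible to K₃. -/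
theorem not_free_pairHull_of_deficient_threeCycle_lit {a b c : ℂ} (hab : cexp a = b) (hbc : cexp b = c)
    (hdef : Algebra.trdeg ℚ ↥(adjoin ℚ ({a, b, c} : Set ℂ)) ≤ 2) :
    ¬ LinearIndependent ℚ ((⨆ n : ℕ, (fun E : Submodule ℚ ℂ => E ⊔ Submodule.span ℚ {x : ℂ | ∃ N : ℕ, N ≤ 2 ∧ ∃ w : Fin N → ℂ, (∃ Y : Finset ℂ, (↑Y : Set ℂ) ⊆ ↑E ∧ ∀ T : Finset ℂ, Y ⊆ T → ∀ (r : ℕ) (ρ : Fin r → Fin N), (∀ j, w j ∈ Submodule.span ℚ ((↑T : Set ℂ) ∪ Set.range (w ∘ ρ))) → Algebra.trdeg ↥(IntermediateField.adjoin ℚ ((↑T : Set ℂ) ∪ Complex.exp '' ↑T)) ↥(IntermediateField.adjoin ↥(IntermediateField.adjoin ℚ ((↑T : Set ℂ) ∪ Complex.exp '' ↑T)) (Set.range w ∪ Set.range (Complex.exp ∘ w))) ≤ r) ∧ x ∈ Set.range w})^[n + 1] (⨆ n : ℕ, (fun E : Submodule ℚ ℂ => E ⊔ Submodule.span ℚ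 {g : ℂ | ∃ Y : Finset ℂ, (↑Y : Set ℂ) ⊆ ↑E ∧ Algebra.trdeg ↥(IntermediateField.adjoin ℚ ((↑Y : Set ℂ) ∪ Complex.exp '' ↑Y)) ↥(IntermediateField.adjoin ↥(IntermediateField.adjoin ℚ ((↑Y : Set ℂ) ∪ Complex.exp '' ↑Y)) ({g, Complex.exp g} : Set ℂ)) ≤ 1})^[n + 1] (⨆ n : ℕ, (fun E : Submodule ℚ ℂ => (E ⊔ Submodule.span ℚ (Complex.exp '' ↑E)) ⊔ Submodule.span ℚ (Complex.exp ⁻¹' ↑(E ⊔ Submodule.span ℚ (Complex.exp '' ↑E))))^[n + 1] (Submodule.span ℚ ({z : ℂ | IsAlgebraic ℚ z} ∪ {z : ℂ | ∃ β l : ℂ, IsAlgebraic ℚ β ∧ IsAlgebraic ℚ (Complex.exp l) ∧ z = β * l}))))).mkQ ∘ ![a, b]) :=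
  fun hfree => by
  have h := (three_le_trdeg_threeCycle_of_free blockStep_pairHullLit_le hab hbc hfree).trans hdef
  norm_num at h

end Summit.Schanuel.Schanuel.Theorems.RootDecomp1JRankKernel

end
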